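import Literature.MathematicalPhysics.StatisticalMechanics.BarlowCoordination
import Summits.Ventures.Crystal3D.Theorems.StickyWulffConstantLayerChainDefs
import HarnessLib

/-!
# The twelve neighbours of a Barlow site as explicit bond VECTORS (helper toward `StackingLiminf`,
# stmt-Ventures-19145; line `LayerChain` v4, front end S1 of stub (B) `MollifiedUpper`)

Cell `crystal3d-full`, venture `Summits/Ventures/Crystal3D`.  The Literature shell theorem
`touching_eq_union` (`Literature/…/BarlowCoordination.lean`) lists the twelve points of the ideal
stacking `barlowStacking 1 √(2/3) σ` at distance `1` from `x = barlowPos 1 √(2/3) σ k i j` by INDEX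
offsets (`offsetPos` over `sixOffsets`, `threeOffsets (−σ k)` one layer up, `threeOffsets (σ(k−1))` one
layer down).  Stub (B) of LayerChain v4 compares mollified layer densities translated by the bond
VECTORS of the `LayerChainDefs` frame (`aVec`, `bPlus`, `bMinus`; bond length `1`, `h = √(2/3)`), so
this file supplies the dictionary (BLUEPRINT-v4B §0, now kernel-checked):

* `offsetPos_layer_eq_sub`, `offsetPos_succ_eq`, `offsetPos_pred_eq` — index offsets as vectors;
* `offsetPos_six`, `offsetPos_up`, `offsetPos_down` — the six in-layer neighbours are `x ∓ aVec m`,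
  the three upper ones `x + b_{σ k, m}`, the three lower ones `x − b_{σ (k−1), m}`
  (`b_{1,m} = bPlus m`, `b_{−1,m} = bMinus m`);
* `mem_touching_iff_twelve_vectors` — `w` is a stacking point at distance `1` from `x` iff it is one
  of these twelve vectors added to `x`.

WHAT THIS IS NOT: any inequality; geometry bookkeeping only.
-/

noncomputable section

namespace Summit.Ventures.Crystal3D.Theorems

open Set
open Literature.MathematicalPhysics.StatisticalMechanics
open Summit.Ventures.Crystal3D.LayerChain (aVec bPlus bMinus)

/-- `h² = (2/3)·1²` for `h = √(2/3)`. -/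
theorem sqrt_two_thirds_sq : Real.sqrt (2 / 3) ^ 2 = 2 / 3 * (1 : ℝ) ^ 2 := by
  rw [Real.sq_sqrt (by norm_num)]; ring

/-- In-layer index offsets are translations by `−P•t₁ − Q•t₂` (`t₁ = aVec 0`, `t₂ = aVec 1`). -/
theorem offsetPos_layer_eq_sub (σ : ℤ → ℤ) (i j k P Q : ℤ) :
    offsetPos 1 (Real.sqrt (2 / 3)) σ i j k (P, Q) =
      barlowPos 1 (Real.sqrt (2 / 3)) σ k i j - (P : ℝ) • WithLp.toLp 2 (aVec 0) -
        (Q : ℝ) • WithLp.toLp 2 (aVec 1) := by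
  ext l
  fin_cases l <;> simp [offsetPos, aVec] <;> ring

/-- One gap UP: `offsetPos i j (k+1) (P,Q) = x + (−P − Q/2 + σ_k/2, −Q√3/2 + σ_k √3/6, h)`. -/
theorem offsetPos_succ_eq (σ : ℤ → ℤ) (i j k P Q : ℤ) :
    offsetPos 1 (Real.sqrt (2 / 3)) σ i j (k + 1) (P, Q) =
      barlowPos 1 (Real.sqrt (2 / 3)) σ k i j +
        WithLp.toLp 2 ![-(P : ℝ) - Q / 2 + σ k / 2,
          -(Q : ℝ) * (Real.sqrt 3 / 2) + σ k * (Real.sqrt 3 / 6), Real.sqrt (2 / 3)] := by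
  ext l
  fin_cases l <;> simp [offsetPos, haggLabel_succ] <;> ring

/-- One gap DOWN: `offsetPos i j (k−1) (P,Q) = x + (−P − Q/2 − σ_{k−1}/2, −Q√3/2 − σ_{k−1}√3/6, −h)`. -/
theorem offsetPos_pred_eq (σ : ℤ → ℤ) (i j k P Q : ℤ) :
    offsetPos 1 (Real.sqrt (2 / 3)) σ i j (k - 1) (P, Q) =
      barlowPos 1 (Real.sqrt (2 / 3)) σ k i j +
        WithLp.toLp 2 ![-(P : ℝ) - Q / 2 - σ (k - 1) / 2,
          -(Q : ℝ) * (Real.sqrt 3 / 2) - σ (k - 1) * (Real.sqrt 3 / 6), -Real.sqrt (2 / 3)] := by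
  have h2 : haggLabel σ (k - 1) = haggLabel σ k - σ (k - 1) := by
    have := haggLabel_sub_haggLabel_pred σ k; linarith
  have hL : (haggLabel σ (k - 1) : ℝ) = haggLabel σ k - σ (k - 1) := by rw [h2]; push_cast; ring
  ext l
  fin_cases l <;> simp [offsetPos, hL] <;> ring

/-- The six in-layer neighbours as vectors: offsets `(1,0),(−1,0),(0,1),(0,−1),(1,−1),(−1,1)` are
`x − a₀, x + a₀, x − a₁, x + a₁, x + a₂, x − a₂`. -/
theorem offsetPos_six (σ : ℤ → ℤ) (i j k : ℤ) :
    offsetPos 1 (Real.sqrt (2 / 3)) σ i j k (1, 0) =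
        barlowPos 1 (Real.sqrt (2 / 3)) σ k i j - WithLp.toLp 2 (aVec 0) ∧
      offsetPos 1 (Real.sqrt (2 / 3)) σ i j k (-1, 0) =
        barlowPos 1 (Real.sqrt (2 / 3)) σ k i j + WithLp.toLp 2 (aVec 0) ∧
      offsetPos 1 (Real.sqrt (2 / 3)) σ i j k (0, 1) =
        barlowPos 1 (Real.sqrt (2 / 3)) σ k i j - WithLp.toLp 2 (aVec 1) ∧
      offsetPos 1 (Real.sqrt (2 / 3)) σ i j k (0, -1) =
        barlowPos 1 (Real.sqrt (2 / 3)) σ k i j + WithLp.toLp 2 (aVec 1) ∧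
      offsetPos 1 (Real.sqrt (2 / 3)) σ i j k (1, -1) =
        barlowPos 1 (Real.sqrt (2 / 3)) σ k i j + WithLp.toLp 2 (aVec 2) ∧
      offsetPos 1 (Real.sqrt (2 / 3)) σ i j k (-1, 1) =
        barlowPos 1 (Real.sqrt (2 / 3)) σ k i j - WithLp.toLp 2 (aVec 2) := by
  refine ⟨?_, ?_, ?_, ?_, ?_, ?_⟩
  · ext l; fin_cases l <;> simp [offsetPos, aVec]; ring
  · ext l; fin_cases l <;> simp [offsetPos, aVec]; ring
  · ext l; fin_cases l <;> simp [offsetPos, aVec] <;> ring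
  · ext l; fin_cases l <;> simp [offsetPos, aVec] <;> ring
  · ext l; fin_cases l <;> simp [offsetPos, aVec] <;> ring
  · ext l; fin_cases l <;> simp [offsetPos, aVec] <;> ring

/-- The three UPPER neighbours as vectors: `x + bPlus m` across a `+1` gap, `x + bMinus m` across a
`−1` gap (offsets `threeOffsets (−σ k)` in the order `(0,0)`, `(∓1,0)`, `(0,∓1)`). -/
theorem offsetPos_up {σ : ℤ → ℤ} (hσ : IsHaggSeq σ) (i j k : ℤ) :
    ∀ PQ ∈ threeOffsets (-σ k), ∃ m : Fin 3,
      offsetPos 1 (Real.sqrt (2 / 3)) σ i j (k + 1) PQ =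
        barlowPos 1 (Real.sqrt (2 / 3)) σ k i j +
          WithLp.toLp 2 (if σ k = 1 then bPlus m else bMinus m) := by
  intro PQ hPQ
  rcases hσ k with h1 | h1
  · have : threeOffsets (-σ k) = {(0, 0), (1, 0), (0, 1)} := by
      simp [threeOffsets, h1]
    rw [this] at hPQ
    simp only [Finset.mem_insert, Finset.mem_singleton] at hPQ
    rcases hPQ with rfl | rfl | rfl
    · refine ⟨0, ?_⟩
      rw [offsetPos_succ_eq]; simp only [h1, if_true]
      congr 1; ext l; fin_cases l <;> simp [bPlus]
    · refine ⟨1, ?_⟩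
      rw [offsetPos_succ_eq]; simp only [h1, if_true]
      congr 1; ext l; fin_cases l <;> simp [bPlus]; ring
    · refine ⟨2, ?_⟩
      rw [offsetPos_succ_eq]; simp only [h1, if_true]
      congr 1; ext l; fin_cases l <;> simp [bPlus]; ring
  · have hne : σ k ≠ 1 := by rw [h1]; norm_num
    have : threeOffsets (-σ k) = {(0, 0), (-1, 0), (0, -1)} := by
      simp [threeOffsets, h1]
    rw [this] at hPQ
    simp only [Finset.mem_insert, Finset.mem_singleton] at hPQ
    rcases hPQ with rfl | rfl | rfl
    · refine ⟨0, ?_⟩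
      rw [offsetPos_succ_eq]; simp only [hne, if_false]
      congr 1; ext l; fin_cases l <;> simp [bMinus, h1]; ring
    · refine ⟨1, ?_⟩
      rw [offsetPos_succ_eq]; simp only [hne, if_false]
      congr 1; ext l; fin_cases l <;> simp [bMinus, h1]; ring
    · refine ⟨2, ?_⟩
      rw [offsetPos_succ_eq]; simp only [hne, if_false]
      congr 1; ext l; fin_cases l <;> simp [bMinus, h1]; ring

/-- The three LOWER neighbours as vectors: `x − b_{σ(k−1), m}`. -/
theorem offsetPos_down {σ : ℤ → ℤ} (hσ : IsHaggSeq σ) (i j k : ℤ) :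
    ∀ PQ ∈ threeOffsets (σ (k - 1)), ∃ m : Fin 3,
      offsetPos 1 (Real.sqrt (2 / 3)) σ i j (k - 1) PQ =
        barlowPos 1 (Real.sqrt (2 / 3)) σ k i j -
          WithLp.toLp 2 (if σ (k - 1) = 1 then bPlus m else bMinus m) := by
  intro PQ hPQ
  rcases hσ (k - 1) with h1 | h1
  · have : threeOffsets (σ (k - 1)) = {(0, 0), (-1, 0), (0, -1)} := by
      simp [threeOffsets, h1]
    rw [this] at hPQ
    simp only [Finset.mem_insert, Finset.mem_singleton] at hPQ
    rcases hPQ with rfl | rfl | rfl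
    · refine ⟨0, ?_⟩
      rw [offsetPos_pred_eq]; simp only [h1, if_true]
      ext l; fin_cases l <;> simp [bPlus] <;> ring
    · refine ⟨1, ?_⟩
      rw [offsetPos_pred_eq]; simp only [h1, if_true]
      ext l; fin_cases l <;> simp [bPlus] <;> ring
    · refine ⟨2, ?_⟩
      rw [offsetPos_pred_eq]; simp only [h1, if_true]
      ext l; fin_cases l <;> simp [bPlus] <;> ring
  · have hne : σ (k - 1) ≠ 1 := by rw [h1]; norm_num
    have : threeOffsets (σ (k - 1)) = {(0, 0), (1, 0), (0, 1)} := by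
      simp [threeOffsets, h1]
    rw [this] at hPQ
    simp only [Finset.mem_insert, Finset.mem_singleton] at hPQ
    rcases hPQ with rfl | rfl | rfl
    · refine ⟨0, ?_⟩
      rw [offsetPos_pred_eq]; simp only [hne, if_false]
      ext l; fin_cases l <;> simp [bMinus, h1] <;> ring
    · refine ⟨1, ?_⟩
      rw [offsetPos_pred_eq]; simp only [hne, if_false]
      ext l; fin_cases l <;> simp [bMinus, h1] <;> ring
    · refine ⟨2, ?_⟩
      rw [offsetPos_pred_eq]; simp only [hne, if_false]
      ext l; fin_cases l <;> simp [bMinus, h1] <;> ring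

/-- Converse dictionary, upper layer: every `x + b_{σ k, m}` is an `offsetPos` one gap up. -/
theorem up_eq_offsetPos {σ : ℤ → ℤ} (hσ : IsHaggSeq σ) (i j k : ℤ) (m : Fin 3) :
    ∃ PQ ∈ threeOffsets (-σ k),
      barlowPos 1 (Real.sqrt (2 / 3)) σ k i j +
          WithLp.toLp 2 (if σ k = 1 then bPlus m else bMinus m) =
        offsetPos 1 (Real.sqrt (2 / 3)) σ i j (k + 1) PQ := by
  rcases hσ k with h1 | h1
  · have hT : threeOffsets (-σ k) = {(0, 0), (1, 0), (0, 1)} := by simp [threeOffsets, h1]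
    fin_cases m
    · refine ⟨(0, 0), by simp [hT], ?_⟩
      rw [offsetPos_succ_eq]; simp only [h1, if_true]
      congr 1; ext l; fin_cases l <;> simp [bPlus]
    · refine ⟨(1, 0), by simp [hT], ?_⟩
      rw [offsetPos_succ_eq]; simp only [h1, if_true]
      congr 1; ext l; fin_cases l <;> simp [bPlus]; ring
    · refine ⟨(0, 1), by simp [hT], ?_⟩
      rw [offsetPos_succ_eq]; simp only [h1, if_true]
      congr 1; ext l; fin_cases l <;> simp [bPlus]; ring
  · have hne : σ k ≠ 1 := by rw [h1]; norm_num
    have hT : threeOffsets (-σ k) = {(0, 0), (-1, 0), (0, -1)} := by simp [threeOffsets, h1]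
    fin_cases m
    · refine ⟨(0, 0), by simp [hT], ?_⟩
      rw [offsetPos_succ_eq]; simp only [hne, if_false]
      congr 1; ext l; fin_cases l <;> simp [bMinus, h1]; ring
    · refine ⟨(-1, 0), by simp [hT], ?_⟩
      rw [offsetPos_succ_eq]; simp only [hne, if_false]
      congr 1; ext l; fin_cases l <;> simp [bMinus, h1]; ring
    · refine ⟨(0, -1), by simp [hT], ?_⟩
      rw [offsetPos_succ_eq]; simp only [hne, if_false]
      congr 1; ext l; fin_cases l <;> simp [bMinus, h1]; ring

/-- Converse dictionary, lower layer: every `x − b_{σ (k−1), m}` is an `offsetPos` one gap down. -/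
theorem down_eq_offsetPos {σ : ℤ → ℤ} (hσ : IsHaggSeq σ) (i j k : ℤ) (m : Fin 3) :
    ∃ PQ ∈ threeOffsets (σ (k - 1)),
      barlowPos 1 (Real.sqrt (2 / 3)) σ k i j -
          WithLp.toLp 2 (if σ (k - 1) = 1 then bPlus m else bMinus m) =
        offsetPos 1 (Real.sqrt (2 / 3)) σ i j (k - 1) PQ := by
  rcases hσ (k - 1) with h1 | h1
  · have hT : threeOffsets (σ (k - 1)) = {(0, 0), (-1, 0), (0, -1)} := by simp [threeOffsets, h1]
    fin_cases m
    · refine ⟨(0, 0), by simp [hT], ?_⟩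
      rw [offsetPos_pred_eq]; simp only [h1, if_true]
      ext l; fin_cases l <;> simp [bPlus] <;> ring
    · refine ⟨(-1, 0), by simp [hT], ?_⟩
      rw [offsetPos_pred_eq]; simp only [h1, if_true]
      ext l; fin_cases l <;> simp [bPlus] <;> ring
    · refine ⟨(0, -1), by simp [hT], ?_⟩
      rw [offsetPos_pred_eq]; simp only [h1, if_true]
      ext l; fin_cases l <;> simp [bPlus] <;> ring
  · have hne : σ (k - 1) ≠ 1 := by rw [h1]; norm_num
    have hT : threeOffsets (σ (k - 1)) = {(0, 0), (1, 0), (0, 1)} := by simp [threeOffsets, h1]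
    fin_cases m
    · refine ⟨(0, 0), by simp [hT], ?_⟩
      rw [offsetPos_pred_eq]; simp only [hne, if_false]
      ext l; fin_cases l <;> simp [bMinus, h1] <;> ring
    · refine ⟨(1, 0), by simp [hT], ?_⟩
      rw [offsetPos_pred_eq]; simp only [hne, if_false]
      ext l; fin_cases l <;> simp [bMinus, h1] <;> ring
    · refine ⟨(0, 1), by simp [hT], ?_⟩
      rw [offsetPos_pred_eq]; simp only [hne, if_false]
      ext l; fin_cases l <;> simp [bMinus, h1] <;> ring

/-- **The shell of a Barlow site as twelve explicit vectors** (membership form). -/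
theorem mem_touching_iff_twelve_vectors {σ : ℤ → ℤ} (hσ : IsHaggSeq σ) (k i j : ℤ)
    (w : EuclideanSpace ℝ (Fin 3)) :
    (w ∈ barlowStacking 1 (Real.sqrt (2 / 3)) σ ∧ dist (barlowPos 1 (Real.sqrt (2 / 3)) σ k i j) w = 1) ↔
      (∃ m : Fin 3, w = barlowPos 1 (Real.sqrt (2 / 3)) σ k i j + WithLp.toLp 2 (aVec m)) ∨
      (∃ m : Fin 3, w = barlowPos 1 (Real.sqrt (2 / 3)) σ k i j - WithLp.toLp 2 (aVec m)) ∨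
      (∃ m : Fin 3, w = barlowPos 1 (Real.sqrt (2 / 3)) σ k i j +
          WithLp.toLp 2 (if σ k = 1 then bPlus m else bMinus m)) ∨
      (∃ m : Fin 3, w = barlowPos 1 (Real.sqrt (2 / 3)) σ k i j -
          WithLp.toLp 2 (if σ (k - 1) = 1 then bPlus m else bMinus m)) := by
  have hset := touching_eq_union hσ one_pos sqrt_two_thirds_sq k i j
  have hmem : (w ∈ barlowStacking 1 (Real.sqrt (2 / 3)) σ ∧
      dist (barlowPos 1 (Real.sqrt (2 / 3)) σ k i j) w = 1) ↔
      w ∈ {w | w ∈ barlowStacking 1 (Real.sqrt (2 / 3)) σ ∧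
        dist (barlowPos 1 (Real.sqrt (2 / 3)) σ k i j) w = 1} := Iff.rfl
  rw [hmem, hset]
  simp only [Set.mem_union, Set.mem_image, Finset.mem_coe]
  obtain ⟨e1, e2, e3, e4, e5, e6⟩ := offsetPos_six σ i j k
  constructor
  · rintro (⟨PQ, hPQ, rfl⟩ | ⟨PQ, hPQ, rfl⟩ | ⟨PQ, hPQ, rfl⟩)
    · -- in-layer
      have h6 : PQ = (1, 0) ∨ PQ = (-1, 0) ∨ PQ = (0, 1) ∨ PQ = (0, -1) ∨ PQ = (1, -1) ∨ PQ = (-1, 1) := by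
        simpa [sixOffsets] using hPQ
      rcases h6 with rfl | rfl | rfl | rfl | rfl | rfl
      · exact Or.inr (Or.inl ⟨0, e1⟩)
      · exact Or.inl ⟨0, e2⟩
      · exact Or.inr (Or.inl ⟨1, e3⟩)
      · exact Or.inl ⟨1, e4⟩
      · exact Or.inl ⟨2, e5⟩
      · exact Or.inr (Or.inl ⟨2, e6⟩)
    · obtain ⟨m, hm⟩ := offsetPos_up hσ i j k PQ hPQ
      exact Or.inr (Or.inr (Or.inl ⟨m, hm⟩))
    · obtain ⟨m, hm⟩ := offsetPos_down hσ i j k PQ hPQ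
      exact Or.inr (Or.inr (Or.inr ⟨m, hm⟩))
  · rintro (⟨m, rfl⟩ | ⟨m, rfl⟩ | ⟨m, rfl⟩ | ⟨m, rfl⟩)
    · refine Or.inl ?_
      fin_cases m
      · exact ⟨(-1, 0), by simp [sixOffsets], e2⟩
      · exact ⟨(0, -1), by simp [sixOffsets], e4⟩
      · exact ⟨(1, -1), by simp [sixOffsets], e5⟩
    · refine Or.inl ?_
      fin_cases m
      · exact ⟨(1, 0), by simp [sixOffsets], e1⟩
      · exact ⟨(0, 1), by simp [sixOffsets], e3⟩
      · exact ⟨(-1, 1), by simp [sixOffsets], e6⟩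
    · obtain ⟨PQ, hPQ, hEq⟩ := up_eq_offsetPos hσ i j k m
      exact Or.inr (Or.inl ⟨PQ, hPQ, hEq.symm⟩)
    · obtain ⟨PQ, hPQ, hEq⟩ := down_eq_offsetPos hσ i j k m
      exact Or.inr (Or.inr ⟨PQ, hPQ, hEq.symm⟩)

end Summit.Ventures.Crystal3D.Theorems

end
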